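import Mathlib
import Literature.Analysis.PDE.GaussianBeam1DRealPart

/-!
# First-order Gaussian beams for `u_tt − u_xx + μ² q(x) u = 0`: the cut-off real beam and the
# pointwise size of its residual

Topic `Literature/Analysis/PDE` (namespace `Literature.Analysis.PDE`). Everything is proved; no
definitions.

The real beam `u = Re(a e^{iμΦ})` of `GaussianBeam1DResidual.lean`/`GaussianBeam1DRealPart.lean`
is a Gaussian of width `(μ Im Γ)^{−1/2}` around the ray `x = X(t)` but is not compactly supported;
the energy method of the tree's one-dimensional wave files wants compactly supported fields. With a
`C²` cut-off `χ` (`χ = 1` on `[−δ₀/2, δ₀/2]`, `χ = 0` off `(−δ₀, δ₀)`) the CUT BEAM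
`G(t,x) = χ(x − X(t)) · u(t,x)` is supported in `|x − X(t)| ≤ δ₀` and (J. Ralston 1982, §2;
J. Sbierski 2015, §3, proof of the second lemma: "the cut-off only adds exponentially small terms")

  `P G = χ · P u + (X′²χ″ − X″χ′ − χ″) u − 2X′χ′ u_t − 2χ′ u_x`        (`cutBeam_residual_eq`),

where the last three terms live on `δ₀/2 ≤ |x − X(t)| ≤ δ₀`, on which the beam is
`O(e^{−μ Im Γ δ₀²/8})`. Combining with the `O(√μ)` pointwise size of `P u`
(`norm_beam_residual_le`, from the exact residual and `gaussian_moment_bounds`, the cubic Taylor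
remainder of `q` being estimated by the mean value inequality from a Lipschitz bound on `q″`), the
residual of the cut beam is `O(√μ)` pointwise on `[0, T]`, uniformly in `x`, with a constant
depending only on sup norms of the (μ-independent) phase functions on `[0, T]`, on `inf Im Γ > 0`,
on `χ` and on `q` near the ray (`cutBeam_residual_pointwise`). This is the input of the energy
estimate for the difference between a true solution and the beam (`GaussianBeam1DEnergy.lean`).

## References

* J. Ralston, *Gaussian beams and the propagation of singularities*, MAA Stud. Math. 23 (1982)
  206–248, §2. Key `Ralston1982`.
* J. Sbierski, Anal. PDE 8 (2015) 1379–1420, §3 (arXiv:1311.2477v2 §2.3, second lemma and the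
  cut-off `u_{λ,𝒩}`). Key `Sbierski2015`.
-/

noncomputable section

namespace Literature.Analysis.PDE

open Set Filter Topology Complex

section Cutoff

variable {q : ℝ → ℝ} {X ξ θ χ : ℝ → ℝ} {Γ a : ℝ → ℂ} {μ ω₀ : ℝ}

/-- Second derivative of a product of `C²` real functions at a point. [folklore] -/
theorem iteratedDeriv_two_mul_real {f g : ℝ → ℝ} {x : ℝ} (hf : ContDiffAt ℝ 2 f x)
    (hg : ContDiffAt ℝ 2 g x) :
    iteratedDeriv 2 (fun s => f s * g s) x
      = iteratedDeriv 2 f x * g x + 2 * deriv f x * deriv g x + f x * iteratedDeriv 2 g x := by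
  rw [iteratedDeriv_fun_mul hf hg]
  simp [Finset.sum_range_succ, iteratedDeriv_one, iteratedDeriv_zero]
  ring

/-- `t`-slices of the moving cut-off `τ ↦ χ(x − X τ)`: first derivative. [folklore] -/
theorem hasDerivAt_cutoff_t (hχ : ContDiff ℝ 2 χ) (hX : ContDiff ℝ 2 X) (x t : ℝ) :
    HasDerivAt (fun τ => χ (x - X τ)) (deriv χ (x - X t) * -(deriv X t)) t := by
  have hχ' : HasDerivAt χ (deriv χ (x - X t)) (x - X t) :=
    (hχ.differentiable two_ne_zero _).hasDerivAt
  have hy : HasDerivAt (fun τ => x - X τ) (-(deriv X t)) t :=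
    ((hX.differentiable two_ne_zero t).hasDerivAt).const_sub x
  exact hχ'.comp t hy

/-- `t`-slices of the moving cut-off: second derivative `X′²χ″ − X″χ′`. [folklore] -/
theorem iteratedDeriv_cutoff_t (hχ : ContDiff ℝ 2 χ) (hX : ContDiff ℝ 2 X) (x t : ℝ) :
    iteratedDeriv 2 (fun τ => χ (x - X τ)) t
      = deriv X t ^ 2 * iteratedDeriv 2 χ (x - X t) - deriv (deriv X) t * deriv χ (x - X t) := by
  have h1 : deriv (fun τ => χ (x - X τ)) = fun τ => deriv χ (x - X τ) * -(deriv X τ) :=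
    funext fun τ => (hasDerivAt_cutoff_t hχ hX x τ).deriv
  rw [iteratedDeriv_succ, iteratedDeriv_one, h1]
  have hdχ : ContDiff ℝ 1 (deriv χ) := hχ.deriv'
  have hχ'' : HasDerivAt (deriv χ) (deriv (deriv χ) (x - X t)) (x - X t) :=
    (hdχ.differentiable one_ne_zero _).hasDerivAt
  have hy : HasDerivAt (fun τ => x - X τ) (-(deriv X t)) t :=
    ((hX.differentiable two_ne_zero t).hasDerivAt).const_sub x
  have hdX : HasDerivAt (deriv X) (deriv (deriv X) t) t :=
    ((hX.deriv').differentiable one_ne_zero t).hasDerivAt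
  have hcomp : HasDerivAt (fun τ => deriv χ (x - X τ)) (deriv (deriv χ) (x - X t) * -deriv X t) t :=
    (hχ''.comp t hy).congr_of_eventuallyEq (Eventually.of_forall fun _ => rfl)
  have h : HasDerivAt (fun τ => deriv χ (x - X τ) * -deriv X τ)
      (deriv (deriv χ) (x - X t) * -deriv X t * -deriv X t
        + deriv χ (x - X t) * -deriv (deriv X) t) t := hcomp.mul hdX.neg
  rw [h.deriv, iteratedDeriv_succ, iteratedDeriv_one]
  ring

/-- `x`-slices of the moving cut-off: second derivative `χ″`. [folklore] -/
theorem iteratedDeriv_cutoff_x (hχ : ContDiff ℝ 2 χ) (x t : ℝ) :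
    deriv (fun y => χ (y - X t)) x = deriv χ (x - X t) ∧
      iteratedDeriv 2 (fun y => χ (y - X t)) x = iteratedDeriv 2 χ (x - X t) := by
  have h1 : ∀ y, HasDerivAt (fun y => χ (y - X t)) (deriv χ (y - X t)) y := fun y =>
    HasDerivAt.comp_sub_const y (X t) ((hχ.differentiable two_ne_zero _).hasDerivAt)
  have hd : deriv (fun y => χ (y - X t)) = fun y => deriv χ (y - X t) := funext fun y => (h1 y).deriv
  refine ⟨(h1 x).deriv, ?_⟩
  rw [iteratedDeriv_succ, iteratedDeriv_one, hd, iteratedDeriv_succ, iteratedDeriv_one]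
  have hdχ : ContDiff ℝ 1 (deriv χ) := hχ.deriv'
  have h2 : HasDerivAt (fun y => deriv χ (y - X t)) (deriv (deriv χ) (x - X t)) x :=
    HasDerivAt.comp_sub_const x (X t) ((hdχ.differentiable one_ne_zero _).hasDerivAt)
  exact h2.deriv

/-- **Residual of the cut beam**: with `u = Re(a e^{iμΦ})` and `G(t,x) = χ(x − X(t)) u(t,x)`,
`P G = χ·Pu + (X′²χ″ − X″χ′ − χ″)u − 2X′χ′u_t − 2χ′u_x`, all cut-off factors at `x − X(t)`.
[cite: Sbierski2015, §3 (arXiv §2.3, second lemma); Ralston1982, §2] -/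
theorem cutBeam_residual_eq (hχ : ContDiff ℝ 2 χ) (hX2 : ContDiff ℝ 2 X) (hξ2 : ContDiff ℝ 2 ξ)
    (hθ2 : ContDiff ℝ 2 θ) (hΓ2 : ContDiff ℝ 2 Γ) (ha2 : ContDiff ℝ 2 a) (t x : ℝ) :
    let u : ℝ → ℝ → ℝ := fun t x => (a t * cexp (I * μ * ((θ t : ℂ) + (ξ t : ℂ) * ((x : ℂ) - X t)
      + Γ t / 2 * ((x : ℂ) - X t) ^ 2))).re
    iteratedDeriv 2 (fun τ => χ (x - X τ) * u τ x) t - iteratedDeriv 2 (fun y => χ (y - X t) * u t y) x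
        + μ ^ 2 * q x * (χ (x - X t) * u t x)
      = χ (x - X t) * (iteratedDeriv 2 (fun τ => u τ x) t - iteratedDeriv 2 (u t) x
          + μ ^ 2 * q x * u t x)
        + (deriv X t ^ 2 * iteratedDeriv 2 χ (x - X t) - deriv (deriv X) t * deriv χ (x - X t)
            - iteratedDeriv 2 χ (x - X t)) * u t x
        - 2 * (deriv X t * deriv χ (x - X t)) * deriv (fun τ => u τ x) t
        - 2 * deriv χ (x - X t) * deriv (u t) x := by
  intro u
  have hut : ContDiff ℝ 2 fun τ => u τ x :=
    Complex.reCLM.contDiff.comp (contDiff_beam_t (μ := μ) hX2 hξ2 hθ2 hΓ2 ha2 x)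
  have hux : ContDiff ℝ 2 fun y => u t y :=
    Complex.reCLM.contDiff.comp (contDiff_beam_x (μ := μ) hX2 hξ2 hθ2 hΓ2 ha2 t)
  have hct : ContDiff ℝ 2 fun τ => χ (x - X τ) := hχ.comp (contDiff_const.sub hX2)
  have hcx : ContDiff ℝ 2 fun y => χ (y - X t) := hχ.comp (contDiff_id.sub contDiff_const)
  rw [iteratedDeriv_two_mul_real hct.contDiffAt hut.contDiffAt,
    iteratedDeriv_two_mul_real hcx.contDiffAt hux.contDiffAt,
    iteratedDeriv_cutoff_t hχ hX2 x t, (iteratedDeriv_cutoff_x hχ x t).1,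
    (iteratedDeriv_cutoff_x hχ x t).2, (hasDerivAt_cutoff_t hχ hX2 x t).deriv]
  ring

/-! ### Pointwise size of the residual of the beam -/

/-- **Cubic Taylor remainder from a Lipschitz bound on `q″`** (mean value inequality twice): if
`|q″(z) − q″(X)| ≤ L|z − X|` on the segment `[[X, X + y]]` then
`|q(X+y) − q(X) − q′(X)y − ½q″(X)y²| ≤ L|y|³`. [folklore] -/
theorem abs_taylor_two_remainder_le (hq : ContDiff ℝ 2 q) {Xc y L : ℝ}
    (hL : ∀ z ∈ uIcc Xc (Xc + y), |iteratedDeriv 2 q z - iteratedDeriv 2 q Xc| ≤ L * |z - Xc|) :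
    |q (Xc + y) - q Xc - deriv q Xc * y - iteratedDeriv 2 q Xc / 2 * y ^ 2| ≤ L * |y| ^ 3 := by
  -- `h(s) = q(X+s) − q(X) − q'(X)s − ½ q''(X) s²`, `h' (s) = q'(X+s) − q'(X) − q''(X) s`
  set h : ℝ → ℝ := fun s => q (Xc + s) - q Xc - deriv q Xc * s - iteratedDeriv 2 q Xc / 2 * s ^ 2
    with hh
  set h1 : ℝ → ℝ := fun s => deriv q (Xc + s) - deriv q Xc - iteratedDeriv 2 q Xc * s with hh1
  have hdq : ∀ z, HasDerivAt q (deriv q z) z := fun z => (hq.differentiable two_ne_zero z).hasDerivAt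
  have hddq : ∀ z, HasDerivAt (deriv q) (iteratedDeriv 2 q z) z := fun z => by
    rw [iteratedDeriv_succ, iteratedDeriv_one]
    exact ((hq.deriv').differentiable one_ne_zero z).hasDerivAt
  have hh' : ∀ s, HasDerivAt h (h1 s) s := by
    intro s
    have e := ((((hdq (Xc + s)).comp s ((hasDerivAt_id s).const_add Xc)).sub_const (q Xc)).sub
      ((hasDerivAt_id s).const_mul (deriv q Xc))).sub (((hasDerivAt_id s).pow 2).const_mul
        (iteratedDeriv 2 q Xc / 2))
    refine e.congr_deriv ?_
    simp only [hh1, id, mul_one, Nat.cast_ofNat]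
    ring
  have hh1' : ∀ s, HasDerivAt h1 (iteratedDeriv 2 q (Xc + s) - iteratedDeriv 2 q Xc) s := by
    intro s
    have e := (((hddq (Xc + s)).comp s ((hasDerivAt_id s).const_add Xc)).sub_const
      (deriv q Xc)).sub ((hasDerivAt_id s).const_mul (iteratedDeriv 2 q Xc))
    refine e.congr_deriv ?_
    simp only [mul_one]
  -- the degenerate case `y = 0`
  rcases eq_or_ne y 0 with hy0 | hy0
  · subst hy0; simp
  -- mean value inequality on `[[0, s]] ⊆ [[0, y]]` for `h1`, then for `h`
  have hL0 : 0 ≤ L := by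
    have h2 := hL (Xc + y) right_mem_uIcc
    have hpos : 0 < |Xc + y - Xc| := by simpa using hy0
    have h3 : 0 ≤ L * |Xc + y - Xc| := (abs_nonneg _).trans h2
    nlinarith
  have habs : ∀ s ∈ uIcc (0:ℝ) y, |s| ≤ |y| := fun s hs => by
    simpa using abs_sub_left_of_mem_uIcc hs
  have hseg : ∀ s ∈ uIcc (0:ℝ) y, Xc + s ∈ uIcc Xc (Xc + y) := by
    intro s hs
    rcases le_total 0 y with hy | hy
    · rw [uIcc_of_le hy] at hs; rw [uIcc_of_le (by linarith)]; exact ⟨by linarith [hs.1], by linarith [hs.2]⟩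
    · rw [uIcc_of_ge hy] at hs; rw [uIcc_of_ge (by linarith)]; exact ⟨by linarith [hs.1], by linarith [hs.2]⟩
  have hb1 : ∀ s ∈ uIcc (0:ℝ) y, |h1 s| ≤ L * |y| * |s| := by
    intro s hs
    have hsub : uIcc (0:ℝ) s ⊆ uIcc 0 y := uIcc_subset_uIcc left_mem_uIcc hs
    have hbound : ∀ r ∈ uIcc (0:ℝ) s, ‖deriv h1 r‖ ≤ L * |y| := by
      intro r hr
      rw [(hh1' r).deriv, Real.norm_eq_abs]
      have h2 := hL (Xc + r) (hseg r (hsub hr))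
      rw [show Xc + r - Xc = r by ring] at h2
      have hr' : |r| ≤ |y| := habs r (hsub hr)
      calc |iteratedDeriv 2 q (Xc + r) - iteratedDeriv 2 q Xc| ≤ L * |r| := h2
        _ ≤ L * |y| := by gcongr
    have hmv := Convex.norm_image_sub_le_of_norm_deriv_le (fun r _ => (hh1' r).differentiableAt)
      hbound (convex_uIcc 0 s) left_mem_uIcc right_mem_uIcc
    simpa [hh1] using hmv
  have hbound : ∀ s ∈ uIcc (0:ℝ) y, ‖deriv h s‖ ≤ L * |y| * |y| := by
    intro s hs
    rw [(hh' s).deriv, Real.norm_eq_abs]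
    have h2 := hb1 s hs
    have hs' : |s| ≤ |y| := habs s hs
    calc |h1 s| ≤ L * |y| * |s| := h2
      _ ≤ L * |y| * |y| := by gcongr
  have hmv := Convex.norm_image_sub_le_of_norm_deriv_le (fun s _ => (hh' s).differentiableAt)
    hbound (convex_uIcc 0 y) left_mem_uIcc right_mem_uIcc
  have h0 : h 0 = 0 := by simp [hh]
  rw [h0, sub_zero, Real.norm_eq_abs, Real.norm_eq_abs, sub_zero] at hmv
  calc |q (Xc + y) - q Xc - deriv q Xc * y - iteratedDeriv 2 q Xc / 2 * y ^ 2| = |h y| := by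
        simp [hh]
    _ ≤ L * |y| * |y| * |y| := hmv
    _ = L * |y| ^ 3 := by ring

/-- **Pointwise size of the beam residual**: with `G = e^{−μβy²/2}` (`β = Im Γ > 0`, `μ ≥ 1`)
and `|R| ≤ M₃|y|³`, the bracket of `beam_residual` obeys
`G·‖μ²a(−A₁Γ₁y³ − ¼Γ₁²y⁴ + R) + iμ(T₁y + T₂y²) + a₂‖ ≤ √μ·M`,
`M = ‖a‖(‖A₁‖‖Γ₁‖ + M₃)(16/β² + 2/β)/2 + 4‖a‖‖Γ₁‖²/β² + ‖T₁‖(2/β + 1)/2 + 2‖T₂‖/β + ‖a₂‖`: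
the residual is `O(√μ)` uniformly in `y`. [cite: Ralston1982, §2; Sbierski2015, §3 (second lemma)] -/
theorem norm_beam_residual_le {μ β y M₃ R : ℝ} (hμ : 1 ≤ μ) (hβ : 0 < β) (hM₃ : 0 ≤ M₃)
    (hR : |R| ≤ M₃ * |y| ^ 3) (A₁ Γ₁ a₀ a₂ T₁ T₂ : ℂ) :
    Real.exp (-(μ * β * y ^ 2 / 2))
        * ‖(μ : ℂ) ^ 2 * a₀ * (-A₁ * Γ₁ * (y : ℂ) ^ 3 - Γ₁ ^ 2 / 4 * (y : ℂ) ^ 4 + (R : ℂ))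
            + I * μ * (T₁ * (y : ℂ) + T₂ * (y : ℂ) ^ 2) + a₂‖
      ≤ Real.sqrt μ * (‖a₀‖ * (‖A₁‖ * ‖Γ₁‖ + M₃) * (16 / β ^ 2 + 2 / β) / 2
          + 4 * ‖a₀‖ * ‖Γ₁‖ ^ 2 / β ^ 2 + ‖T₁‖ * (2 / β + 1) / 2 + 2 * ‖T₂‖ / β + ‖a₂‖) := by
  obtain ⟨k2, k4, k1, k3, k0⟩ := gaussian_moment_bounds hμ hβ y
  set G : ℝ := Real.exp (-(μ * β * y ^ 2 / 2)) with hG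
  have hG0 : 0 ≤ G := (Real.exp_pos _).le
  have hμ0 : 0 ≤ μ := by linarith
  have hs1 : 1 ≤ Real.sqrt μ := by rw [← Real.sqrt_one]; exact Real.sqrt_le_sqrt hμ
  -- norms of the real ingredients
  have ny : ‖(y : ℂ)‖ = |y| := Complex.norm_real y
  have nμ : ‖(μ : ℂ)‖ = μ := by rw [Complex.norm_real, Real.norm_eq_abs, abs_of_nonneg hμ0]
  have nR : ‖(R : ℂ)‖ ≤ M₃ * |y| ^ 3 := by rw [Complex.norm_real, Real.norm_eq_abs]; exact hR
  -- triangle inequality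
  have h1 : ‖(μ : ℂ) ^ 2 * a₀ * (-A₁ * Γ₁ * (y : ℂ) ^ 3 - Γ₁ ^ 2 / 4 * (y : ℂ) ^ 4 + (R : ℂ))‖
      ≤ μ ^ 2 * ‖a₀‖ * (‖A₁‖ * ‖Γ₁‖ * |y| ^ 3 + ‖Γ₁‖ ^ 2 / 4 * |y| ^ 4 + M₃ * |y| ^ 3) := by
    rw [norm_mul, norm_mul, norm_pow, nμ]
    gcongr
    calc ‖-A₁ * Γ₁ * (y : ℂ) ^ 3 - Γ₁ ^ 2 / 4 * (y : ℂ) ^ 4 + (R : ℂ)‖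
        ≤ ‖-A₁ * Γ₁ * (y : ℂ) ^ 3‖ + ‖Γ₁ ^ 2 / 4 * (y : ℂ) ^ 4‖ + ‖(R : ℂ)‖ := by
          refine (norm_add_le _ _).trans ?_
          gcongr
          exact norm_sub_le _ _
      _ ≤ ‖A₁‖ * ‖Γ₁‖ * |y| ^ 3 + ‖Γ₁‖ ^ 2 / 4 * |y| ^ 4 + M₃ * |y| ^ 3 := by
          gcongr
          · rw [norm_mul, norm_mul, norm_neg, norm_pow, ny]
          · rw [norm_mul, norm_div, norm_pow, norm_pow, ny]
            simp
  have h2 : ‖I * μ * (T₁ * (y : ℂ) + T₂ * (y : ℂ) ^ 2)‖ ≤ μ * (‖T₁‖ * |y| + ‖T₂‖ * |y| ^ 2) := by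
    rw [norm_mul, norm_mul, Complex.norm_I, one_mul, nμ]
    gcongr
    calc ‖T₁ * (y : ℂ) + T₂ * (y : ℂ) ^ 2‖ ≤ ‖T₁ * (y : ℂ)‖ + ‖T₂ * (y : ℂ) ^ 2‖ := norm_add_le _ _
      _ = ‖T₁‖ * |y| + ‖T₂‖ * |y| ^ 2 := by rw [norm_mul, norm_mul, norm_pow, ny]
  have htri : ‖(μ : ℂ) ^ 2 * a₀ * (-A₁ * Γ₁ * (y : ℂ) ^ 3 - Γ₁ ^ 2 / 4 * (y : ℂ) ^ 4 + (R : ℂ))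
        + I * μ * (T₁ * (y : ℂ) + T₂ * (y : ℂ) ^ 2) + a₂‖
      ≤ μ ^ 2 * ‖a₀‖ * (‖A₁‖ * ‖Γ₁‖ * |y| ^ 3 + ‖Γ₁‖ ^ 2 / 4 * |y| ^ 4 + M₃ * |y| ^ 3)
        + μ * (‖T₁‖ * |y| + ‖T₂‖ * |y| ^ 2) + ‖a₂‖ :=
    (norm_add₃_le).trans (by gcongr)
  -- multiply by the Gaussian and use the moment bounds
  have hy2 : |y| ^ 2 = y ^ 2 := sq_abs y
  have hy4 : |y| ^ 4 = y ^ 4 := by rw [show |y| ^ 4 = (|y| ^ 2) ^ 2 by ring, hy2]; ring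
  have e : G * (μ ^ 2 * ‖a₀‖ * (‖A₁‖ * ‖Γ₁‖ * |y| ^ 3 + ‖Γ₁‖ ^ 2 / 4 * |y| ^ 4 + M₃ * |y| ^ 3)
        + μ * (‖T₁‖ * |y| + ‖T₂‖ * |y| ^ 2) + ‖a₂‖)
      = ‖a₀‖ * (‖A₁‖ * ‖Γ₁‖ + M₃) * (μ ^ 2 * |y| ^ 3 * G)
        + ‖a₀‖ * ‖Γ₁‖ ^ 2 / 4 * (μ ^ 2 * y ^ 4 * G)
        + ‖T₁‖ * (μ * |y| * G) + ‖T₂‖ * (μ * y ^ 2 * G) + ‖a₂‖ * G := by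
    rw [hy4, hy2]; ring
  calc G * ‖(μ : ℂ) ^ 2 * a₀ * (-A₁ * Γ₁ * (y : ℂ) ^ 3 - Γ₁ ^ 2 / 4 * (y : ℂ) ^ 4 + (R : ℂ))
          + I * μ * (T₁ * (y : ℂ) + T₂ * (y : ℂ) ^ 2) + a₂‖
      ≤ G * (μ ^ 2 * ‖a₀‖ * (‖A₁‖ * ‖Γ₁‖ * |y| ^ 3 + ‖Γ₁‖ ^ 2 / 4 * |y| ^ 4 + M₃ * |y| ^ 3)
        + μ * (‖T₁‖ * |y| + ‖T₂‖ * |y| ^ 2) + ‖a₂‖) := by gcongr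
    _ = ‖a₀‖ * (‖A₁‖ * ‖Γ₁‖ + M₃) * (μ ^ 2 * |y| ^ 3 * G)
        + ‖a₀‖ * ‖Γ₁‖ ^ 2 / 4 * (μ ^ 2 * y ^ 4 * G)
        + ‖T₁‖ * (μ * |y| * G) + ‖T₂‖ * (μ * y ^ 2 * G) + ‖a₂‖ * G := e
    _ ≤ ‖a₀‖ * (‖A₁‖ * ‖Γ₁‖ + M₃) * (Real.sqrt μ * (16 / β ^ 2 + 2 / β) / 2)
        + ‖a₀‖ * ‖Γ₁‖ ^ 2 / 4 * (16 / β ^ 2)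
        + ‖T₁‖ * (Real.sqrt μ * (2 / β + 1) / 2) + ‖T₂‖ * (2 / β) + ‖a₂‖ * 1 := by
          gcongr
    _ ≤ Real.sqrt μ * (‖a₀‖ * (‖A₁‖ * ‖Γ₁‖ + M₃) * (16 / β ^ 2 + 2 / β) / 2
          + 4 * ‖a₀‖ * ‖Γ₁‖ ^ 2 / β ^ 2 + ‖T₁‖ * (2 / β + 1) / 2 + 2 * ‖T₂‖ / β + ‖a₂‖) := by
          have hK : 0 ≤ 4 * ‖a₀‖ * ‖Γ₁‖ ^ 2 / β ^ 2 + 2 * ‖T₂‖ / β + ‖a₂‖ := by positivity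
          have hdiff : Real.sqrt μ * (‖a₀‖ * (‖A₁‖ * ‖Γ₁‖ + M₃) * (16 / β ^ 2 + 2 / β) / 2
                + 4 * ‖a₀‖ * ‖Γ₁‖ ^ 2 / β ^ 2 + ‖T₁‖ * (2 / β + 1) / 2 + 2 * ‖T₂‖ / β + ‖a₂‖)
              - (‖a₀‖ * (‖A₁‖ * ‖Γ₁‖ + M₃) * (Real.sqrt μ * (16 / β ^ 2 + 2 / β) / 2)
                + ‖a₀‖ * ‖Γ₁‖ ^ 2 / 4 * (16 / β ^ 2)
                + ‖T₁‖ * (Real.sqrt μ * (2 / β + 1) / 2) + ‖T₂‖ * (2 / β) + ‖a₂‖ * 1)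
              = (Real.sqrt μ - 1) * (4 * ‖a₀‖ * ‖Γ₁‖ ^ 2 / β ^ 2 + 2 * ‖T₂‖ / β + ‖a₂‖) := by
            ring
          have hnn : 0 ≤ (Real.sqrt μ - 1) * (4 * ‖a₀‖ * ‖Γ₁‖ ^ 2 / β ^ 2 + 2 * ‖T₂‖ / β + ‖a₂‖) :=
            mul_nonneg (by linarith) hK
          linarith

/-! ### Size of the beam and of its first derivatives (for the cut-off terms) -/

/-- `‖F(t,x)‖ = ‖a(t)‖ e^{−μ Im Γ y²/2}`. [cite: Ralston1982, §2] -/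
theorem norm_beam_eq (t x : ℝ) :
    ‖a t * cexp (I * μ * ((θ t : ℂ) + (ξ t : ℂ) * ((x : ℂ) - X t) + Γ t / 2 * ((x : ℂ) - X t) ^ 2))‖
      = ‖a t‖ * Real.exp (-(μ * (Γ t).im * (x - X t) ^ 2 / 2)) := by
  rw [norm_mul, norm_cexp_beamPhase]

/-- `‖F_t‖ ≤ (‖a′‖ + |μ|·‖Φ_t‖·‖a‖) e^{−μ Im Γ y²/2}`. [cite: Ralston1982, §2] -/
theorem norm_beam_t_le (hX : ContDiff ℝ 1 X) (hξ : ContDiff ℝ 1 ξ) (hθ : ContDiff ℝ 1 θ)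
    (hΓ : ContDiff ℝ 1 Γ) (ha : ContDiff ℝ 1 a) (t x : ℝ) :
    ‖deriv (fun τ => a τ * cexp (I * μ * ((θ τ : ℂ) + (ξ τ : ℂ) * ((x : ℂ) - X τ)
        + Γ τ / 2 * ((x : ℂ) - X τ) ^ 2))) t‖
      ≤ (‖deriv a t‖ + |μ| * ‖((deriv θ t : ℝ) : ℂ) + ((deriv ξ t : ℝ) : ℂ) * ((x : ℂ) - X t)
          - (ξ t : ℂ) * ((deriv X t : ℝ) : ℂ) + deriv Γ t / 2 * ((x : ℂ) - X t) ^ 2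
          - Γ t * ((x : ℂ) - X t) * ((deriv X t : ℝ) : ℂ)‖ * ‖a t‖)
        * Real.exp (-(μ * (Γ t).im * (x - X t) ^ 2 / 2)) := by
  rw [(hasDerivAt_beam_t hX hξ hθ hΓ ha x t).deriv, norm_mul, norm_cexp_beamPhase]
  gcongr
  refine (norm_add_le _ _).trans ?_
  gcongr
  rw [norm_mul, norm_mul, norm_mul, Complex.norm_I, one_mul, Complex.norm_real, Real.norm_eq_abs]

/-- `‖F_x‖ = |μ|·‖ξ + Γy‖·‖a‖ e^{−μ Im Γ y²/2}`. [cite: Ralston1982, §2] -/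
theorem norm_beam_x_eq (t x : ℝ) :
    ‖deriv (fun y : ℝ => a t * cexp (I * μ * ((θ t : ℂ) + (ξ t : ℂ) * ((y : ℂ) - X t)
        + Γ t / 2 * ((y : ℂ) - X t) ^ 2))) x‖
      = |μ| * ‖(ξ t : ℂ) + Γ t * ((x : ℂ) - X t)‖ * ‖a t‖
        * Real.exp (-(μ * (Γ t).im * (x - X t) ^ 2 / 2)) := by
  rw [(hasDerivAt_beam_x (μ := μ) (X := X) (ξ := ξ) (θ := θ) (Γ := Γ) (a := a) x t).deriv,
    norm_mul, norm_mul, norm_cexp_beamPhase, norm_mul, norm_mul, Complex.norm_I, one_mul,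
    Complex.norm_real, Real.norm_eq_abs]
  ring

/-- **Exponential smallness off the ray**: on `δ₀/2 ≤ |y|`, `e^{−μβy²/2} ≤ e^{−μβδ₀²/8}` and
`μ e^{−μβy²/2} ≤ 8/(βδ₀²)` (`β > 0`, `μ ≥ 0`). [folklore] -/
theorem gaussian_off_ray_le {μ β δ₀ y : ℝ} (hμ : 0 ≤ μ) (hβ : 0 < β) (hδ : 0 < δ₀)
    (hy : δ₀ / 2 ≤ |y|) :
    Real.exp (-(μ * β * y ^ 2 / 2)) ≤ Real.exp (-(μ * β * δ₀ ^ 2 / 8)) ∧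
      μ * Real.exp (-(μ * β * y ^ 2 / 2)) ≤ 8 / (β * δ₀ ^ 2) := by
  have hy2 : δ₀ ^ 2 / 4 ≤ y ^ 2 := by
    have h := pow_le_pow_left₀ (by positivity) hy 2
    rw [sq_abs] at h
    nlinarith
  have h1 : Real.exp (-(μ * β * y ^ 2 / 2)) ≤ Real.exp (-(μ * β * δ₀ ^ 2 / 8)) := by
    apply Real.exp_le_exp.2
    have : μ * β * (δ₀ ^ 2 / 4) ≤ μ * β * y ^ 2 := by gcongr
    linarith
  refine ⟨h1, ?_⟩
  set w : ℝ := μ * β * δ₀ ^ 2 / 8 with hw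
  have hw0 : 0 ≤ w := by positivity
  obtain ⟨e1, -⟩ := mul_exp_neg_le hw0
  have : μ = 8 / (β * δ₀ ^ 2) * w := by simp only [hw]; field_simp
  calc μ * Real.exp (-(μ * β * y ^ 2 / 2)) ≤ μ * Real.exp (-w) := by rw [hw]; gcongr
    _ = 8 / (β * δ₀ ^ 2) * (w * Real.exp (-w)) := by rw [this]; ring
    _ ≤ 8 / (β * δ₀ ^ 2) * 1 := by gcongr
    _ = 8 / (β * δ₀ ^ 2) := mul_one _

end Cutoff

end Literature.Analysis.PDE
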